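import Summits.QuantumFields.YangMills.Theorems.LangevinControlUVOSLegsAtWeakCouplingCStubLocalityNear
import Summits.QuantumFields.YangMills.Theorems.LangevinControlUVOSLegsAtWeakCouplingCStubLocalityReduction
import Summits.QuantumFields.YangMills.Theorems.LangevinControlUVOSLegsAtWeakCouplingCStubLocalityNullSet
import HarnessLib

/-!
# Stub `stub_locality` of line `Sketch` (crux `OSLegsAtWeakCouplingC`, stmt-QuantumFields-16207): E1 is local

Registered stub `stub_locality : Statement.stub_locality` (CDefs §2): for a one-field family `S₁` on `⁰𝒮(ℝ⁴)` with
`S₁ 0 = ev`, translation invariance on `⁰𝒮`, E3, E0′, reflection positivity on positive-time tuples (`RPPos`),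
invariance under the signed permutations of the axes and bounded densities off the diagonal, an isometry `R` of the
`(x₀,x₁)`-plane fixing `S₁` on the germ (off-diagonal test functions supported in configurations of diameter `< r₀`)
fixes `S₁` on all of `⁰𝒮`.

Assembly (continuation lead c2's rebuild; files A Gaps, B Cut, C1 BumpBounds, C2 Sector, D1 Chamber, D2 Near, and the
workers' Identity / Reduction / NullSet):
* arities `n ≤ 1`: every configuration of at most one point has diameter `0 < r₀`, so germ invariance is already the
  claim;
* arities `n = q + 2`: the landed reduction `invariant_of_local_bumpInvariance` (flat approximation inside `⁰𝒮`,
  null-set closure through `OffDiagDensity`, regularisation by radial product bumps) asks for local bump invariance off a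
  closed null set; the set of coordinate coincidences of `c` and `R ∘ c` is closed and null
  (`isClosed_null_coordCoincidence`) and off it `local_bumpInvariance` holds (sector holomorphy of the product-bump
  function in the gap coordinates along every axis, convex chambers reaching the germ, identity theorem).
Neither planarity of `R` nor `S₁ 0 = ev` / E0′ are needed.  Refs: OsterwalderSchraderCMP1975 Ch. V; StreaterWightman1964
§2-3 (real environments); GlimmJaffe1987 §19.
-/

set_option autoImplicit false

noncomputable section

open Literature.MathematicalPhysics.QuantumLattice Literature.MathematicalPhysics.AQFT
open Summit.QuantumFields.YangMills.Theorems.OSLegsAtWeakCouplingC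
open Summit.QuantumFields.YangMills.Theorems.OSLegsAtWeakCouplingC.Loc

namespace Summit.QuantumFields.YangMills.Cruxes.OSLegsAtWeakCouplingC.Sketch

/-- **E1 is local at the origin** (registered stub `stub_locality` of line `Sketch`): a planar isometry fixing a
one-field family on the germ fixes it on all of `⁰𝒮`, for families with translation invariance, E3, `RPPos`,
signed-permutation invariance and bounded densities off the diagonal. -/
theorem stub_locality : Statement.stub_locality := by
  intro S₁ _ htrans hE3 _ hRP hsigned hdens R _ r₀ hr₀ hgermR
  -- arities `≥ 2`: reduction + null set + local bump invariance
  have h2 : ∀ n : ℕ, 2 ≤ n → ∀ F : SchwartzMap (Fin n → EuclideanSpace ℝ (Fin 4)) ℂ,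
      IsOffDiagonal F → S₁ n (linActMulti R F) = S₁ n F := by
    refine invariant_of_local_bumpInvariance S₁ hdens R fun n hn => ?_
    obtain ⟨q, rfl⟩ : ∃ q, n = q + 2 := ⟨n - 2, by omega⟩
    exact ⟨_, (isClosed_null_coordCoincidence (q + 2) R).1, (isClosed_null_coordCoincidence (q + 2) R).2,
      fun c hc => local_bumpInvariance htrans hE3 hRP hsigned hdens R hr₀ hgermR c hc⟩
  intro n F hF
  rcases Nat.lt_or_ge n 2 with hn | hn
  · -- arities `≤ 1`: the support has diameter `0`
    refine hgermR n F hF fun x _ i j => ?_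
    interval_cases n
    · exact Fin.elim0 i
    · have hij : i = j := Subsingleton.elim i j
      subst hij
      simpa using hr₀
  · exact h2 n hn F hF

end Summit.QuantumFields.YangMills.Cruxes.OSLegsAtWeakCouplingC.Sketch

end
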